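import Literature.MathematicalPhysics.QuantumLattice.TorusShellCountUniform
import Literature.MathematicalPhysics.QuantumLattice.TorusShellCounting
import HarnessLib

/-!
# Shell counting on the torus at the van Hove rate: `#{|ε_L(k) - μ| < η} ≤ 6 η log(4/η) L² + 52 L`, uniformly in `μ`

Family `hubbard` / topic `MathematicalPhysics/QuantumLattice`; companion of
`TorusShellCountUniform.lean` (`card_torusShell_le_sqrt`: the crude but level-uniform count
`√η L² + 2L`) and `TorusShellCounting.lean` (`card_torusShell_le`: the linear count `≲ ηL²/√d₀ + L`
for levels at distance `≥ d₀` from the critical values `{-4, 0, 4}`). Here the count that is BOTH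
uniform in the level `μ` AND sharp up to the logarithm forced by the van Hove saddle points
`(0, π), (π, 0)` of the band `ε_L(k) = -2cos(2πk₁/L) - 2cos(2πk₂/L)` (`torusBand`):

* `card_filter_abs_sin_le` — `#{a ∈ ℤ/Lℤ : |sin(2πa/L)| ≤ σ} ≤ √2 σ L + 4` (the momenta near the
  two flat points `cos = ±1` of a row; from `card_filter_cos_ge_le`, `card_filter_cos_le_le`);
* `sum_inv_max_abs_sin_le` — the dyadic row sum `Σ_{a ∈ ℤ/Lℤ} 1/max(|sin(2πa/L)|, 2^{-M}) ≤
  (2M + 1)√2 L + 12·2^M` (discrete `∫ dθ / max(|sin θ|, τ) ≍ log(1/τ)`);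
* `card_shell_dir_weighted_le` — the momenta of the shell `|ε_L(k) - μ| < η` whose `i`-th sine
  dominates both the other sine and `τ` are at most `Σ_r (ηL/(π max(|sin θ_r|, τ)) + 2)` (fibre over
  the other coordinate `r`; on a row, `cos` is bi-Lipschitz where `|sin| ≥ s₀`, `card_row_le`);
* `card_torusShell_lt_le_log` — **for every level `μ` and `0 < η ≤ 1`:
  `#{k ∈ (ℤ/Lℤ)² : |ε_L(k) - μ| < η} ≤ 6 η log(4/η) L² + 52 L`** (corner `max |sin θ_i| ≤ τ ≍ √η`
  has `≤ (√2 τ L + 4)²` momenta; the rest is covered by the two directional classes);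
  `card_torusShell_lt_le_log'` — the same written for `0 < η ≤ 4` with `log(16/η)`.

This is the finite-volume form of "the `d = 2` tight-binding density of states is `O(log(1/|E|))`
at the van Hove energy and bounded elsewhere", with the unavoidable `O(L)` rounding term (a whole
row of `L` momenta lies ON the level set `ε = 0`). Consumers: the level-uniform logarithmic
inverse-gap sum `Σ_{|ξ| ≥ e₀} 1/|ξ| = O(L² log²(1/e₀))` (`TorusInverseGapSumLog.lean`) and the
filling-uniform pairing-cost rate `a / log²(1/a)` (`FreeFermiGasPairingCostUniform.lean`).

Sources: folklore lattice-point counting; the van Hove logarithm: L. Van Hove, Phys. Rev. 89 (1953)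
1189. No named facts, no definitions.

## Mathlib / tree search

Tree: `card_row_le`, `torusBand_two_eq` (`TorusShellCounting`), `card_filter_cos_ge_le`,
`card_filter_cos_le_le` (`TorusCooperSumFermiLevel`), `card_torusShell_le_sqrt`, `card_torusSite`.
Mathlib: `exists_nat_pow_near`, `Finset.card_le_card_of_injOn`, `Finset.card_eq_sum_card_fiberwise`,
`Finset.card_product`, `geom_sum_eq`, `Real.log_two_gt_d9`, `Real.sqrt_two_lt_three_halves`,
`Real.log_le_log`, `Real.log_pow`, `Real.abs_sin_le_one`, `Real.sin_sq_add_cos_sq`.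
-/

noncomputable section

namespace Literature.MathematicalPhysics.QuantumLattice

open Real Finset Literature.Probability.LatticeModels

/-! ### One-dimensional counts -/

section OneDim

variable {L : ℕ} [NeZero L]

/-- **Momenta near the flat points of a row.** For `σ ≥ 0`,
`#{a ∈ ℤ/Lℤ : |sin(2πa/L)| ≤ σ} ≤ √2 σ L + 4`: `|sin θ| ≤ σ` forces `|cos θ| ≥ 1 - σ²`, i.e.
`cos θ ≥ 1 - s²/2` or `cos θ ≤ -1 + s²/2` with `s = √2 σ`, and each of these holds for at most
`sL/2 + 2` momenta (`card_filter_cos_ge_le`, `card_filter_cos_le_le`). [folklore] -/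
theorem card_filter_abs_sin_le {σ : ℝ} (hσ : 0 ≤ σ) :
    ((univ.filter fun a : ZMod L => |Real.sin (2 * π * (a.val : ℝ) / L)| ≤ σ).card : ℝ) ≤
      Real.sqrt 2 * σ * L + 4 := by
  classical
  set s : ℝ := Real.sqrt 2 * σ with hs
  have hs0 : 0 ≤ s := by positivity
  have hs2 : s ^ 2 / 2 = σ ^ 2 := by
    rw [hs, mul_pow, Real.sq_sqrt (by norm_num : (0 : ℝ) ≤ 2)]; ring
  set A := univ.filter fun n : ZMod L => 1 - s ^ 2 / 2 ≤ Real.cos (2 * π * n.val / L) with hA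
  set B := univ.filter fun n : ZMod L => Real.cos (2 * π * n.val / L) ≤ -1 + s ^ 2 / 2 with hB
  have hsub : (univ.filter fun a : ZMod L => |Real.sin (2 * π * (a.val : ℝ) / L)| ≤ σ) ⊆ A ∪ B := by
    intro a ha
    rw [Finset.mem_filter] at ha
    have hsin : Real.sin (2 * π * (a.val : ℝ) / L) ^ 2 ≤ σ ^ 2 := by
      rw [← sq_abs]
      exact pow_le_pow_left₀ (abs_nonneg _) ha.2 2
    have hcos2 : 1 - σ ^ 2 ≤ Real.cos (2 * π * (a.val : ℝ) / L) ^ 2 := by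
      nlinarith [Real.sin_sq_add_cos_sq (2 * π * (a.val : ℝ) / L)]
    have hc1 := Real.abs_cos_le_one (2 * π * (a.val : ℝ) / L)
    have habs : 1 - σ ^ 2 ≤ |Real.cos (2 * π * (a.val : ℝ) / L)| := by
      have h1 : Real.cos (2 * π * (a.val : ℝ) / L) ^ 2 ≤ |Real.cos (2 * π * (a.val : ℝ) / L)| := by
        rw [← sq_abs]
        nlinarith [abs_nonneg (Real.cos (2 * π * (a.val : ℝ) / L))]
      linarith
    rw [Finset.mem_union, hA, hB, Finset.mem_filter, Finset.mem_filter, hs2]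
    rcases le_or_gt 0 (Real.cos (2 * π * (a.val : ℝ) / L)) with h | h
    · left
      rw [abs_of_nonneg h] at habs
      exact ⟨Finset.mem_univ _, by linarith⟩
    · right
      rw [abs_of_neg h] at habs
      exact ⟨Finset.mem_univ _, by linarith⟩
  have hA' : (A.card : ℝ) ≤ s * L / 2 + 2 := card_filter_cos_ge_le hs0
  have hB' : (B.card : ℝ) ≤ s * L / 2 + 2 := card_filter_cos_le_le hs0
  calc ((univ.filter fun a : ZMod L => |Real.sin (2 * π * (a.val : ℝ) / L)| ≤ σ).card : ℝ)
      ≤ ((A ∪ B).card : ℝ) := by exact_mod_cast Finset.card_le_card hsub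
    _ ≤ (A.card : ℝ) + B.card := by exact_mod_cast Finset.card_union_le A B
    _ ≤ (s * L / 2 + 2) + (s * L / 2 + 2) := add_le_add hA' hB'
    _ = Real.sqrt 2 * σ * L + 4 := by rw [hs]; ring

/-- **Dyadic row sum.** For every `M`,
`Σ_{a ∈ ℤ/Lℤ} 1/max(|sin(2πa/L)|, 2^{-M}) ≤ (2M + 1)·√2·L + 12·2^M`: pointwise,
`1/max(t, 2^{-M}) ≤ Σ_{m<M} [2^{-(m+1)} ≤ t ≤ 2^{-m}]·2^{m+1} + [t ≤ 2^{-M}]·2^M`, and each band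
`{t ≤ 2^{-m}}` holds at most `√2·2^{-m}L + 4` momenta (`card_filter_abs_sin_le`). The discrete
form of `∫₀^{2π} dθ/max(|sin θ|, τ) = O(log(1/τ))`. [folklore] -/
theorem sum_inv_max_abs_sin_le (M : ℕ) :
    ∑ a : ZMod L, 1 / max |Real.sin (2 * π * (a.val : ℝ) / L)| ((1 / 2 : ℝ) ^ M) ≤
      (2 * M + 1) * Real.sqrt 2 * L + 12 * 2 ^ M := by
  classical
  set t : ZMod L → ℝ := fun a => |Real.sin (2 * π * (a.val : ℝ) / L)| with ht
  set τ : ℝ := (1 / 2 : ℝ) ^ M with hτ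
  have hτ0 : 0 < τ := by positivity
  have hτ2 : τ * 2 ^ M = 1 := by rw [hτ, ← mul_pow]; norm_num
  have hτinv : 1 / τ = 2 ^ M := by
    rw [div_eq_iff hτ0.ne', mul_comm]; exact hτ2.symm
  set band : ℕ → ZMod L → Prop := fun m a => (1 / 2 : ℝ) ^ (m + 1) ≤ t a ∧ t a ≤ (1 / 2 : ℝ) ^ m
    with hband
  -- pointwise dyadic bound
  have hpt : ∀ a : ZMod L, 1 / max (t a) τ ≤
      ∑ m ∈ Finset.range M, (if band m a then (2 : ℝ) ^ (m + 1) else 0) +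
        (if t a ≤ τ then (2 : ℝ) ^ M else 0) := by
    intro a
    have hterm0 : ∀ m ∈ Finset.range M, (0 : ℝ) ≤ if band m a then (2 : ℝ) ^ (m + 1) else 0 := by
      intro m _; split_ifs <;> positivity
    have hsum0 := Finset.sum_nonneg hterm0
    by_cases hle : t a ≤ τ
    · rw [max_eq_right hle, if_pos hle, hτinv]
      linarith
    · push Not at hle
      rw [max_eq_left hle.le, if_neg (not_le.2 hle), add_zero]
      have ht1 : t a ≤ 1 := Real.abs_sin_le_one _
      have hta0 : 0 < t a := hτ0.trans hle
      obtain ⟨m, hm1, hm2⟩ := exists_nat_pow_near (x := 1 / t a) (y := (2 : ℝ))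
        (by rw [le_div_iff₀ hta0]; linarith) (by norm_num)
      -- `2^m ≤ 1/t < 2^(m+1)`
      have hmM : m < M := by
        by_contra h
        push Not at h
        have h2 : (2 : ℝ) ^ M ≤ 2 ^ m := pow_le_pow_right₀ (by norm_num) h
        have h3 : (2 : ℝ) ^ M ≤ 1 / t a := h2.trans hm1
        rw [le_div_iff₀ hta0] at h3
        have : t a ≤ τ := by
          rw [hτ, one_div_pow, le_div_iff₀ (by positivity)]
          linarith
        linarith
      have hb : band m a := by
        constructor
        · rw [one_div_pow, div_le_iff₀ (by positivity)]
          have h := hm2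
          rw [div_lt_iff₀ hta0] at h
          linarith
        · rw [one_div_pow, le_div_iff₀ (by positivity)]
          rw [le_div_iff₀ hta0] at hm1
          linarith
      have hsingle : (if band m a then (2 : ℝ) ^ (m + 1) else 0) ≤
          ∑ m ∈ Finset.range M, (if band m a then (2 : ℝ) ^ (m + 1) else 0) :=
        Finset.single_le_sum hterm0 (Finset.mem_range.2 hmM)
      rw [if_pos hb] at hsingle
      exact hm2.le.trans hsingle
  -- the band counts
  have hcount : ∀ m : ℕ, (((univ.filter fun a : ZMod L => band m a)).card : ℝ) ≤
      Real.sqrt 2 * (1 / 2 : ℝ) ^ m * L + 4 := by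
    intro m
    calc (((univ.filter fun a : ZMod L => band m a)).card : ℝ)
        ≤ ((univ.filter fun a : ZMod L => |Real.sin (2 * π * (a.val : ℝ) / L)| ≤ (1 / 2 : ℝ) ^ m).card : ℝ) := by
          exact_mod_cast Finset.card_le_card fun a ha => by
            rw [Finset.mem_filter] at ha ⊢
            exact ⟨ha.1, ha.2.2⟩
      _ ≤ Real.sqrt 2 * (1 / 2 : ℝ) ^ m * L + 4 := card_filter_abs_sin_le (by positivity)
  have htail : (((univ.filter fun a : ZMod L => t a ≤ τ)).card : ℝ) ≤ Real.sqrt 2 * τ * L + 4 :=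
    card_filter_abs_sin_le hτ0.le
  have hL0 : (0 : ℝ) ≤ L := Nat.cast_nonneg _
  have hs2 : (0 : ℝ) ≤ Real.sqrt 2 := Real.sqrt_nonneg _
  -- sum the pointwise bound
  calc ∑ a : ZMod L, 1 / max (t a) τ
      ≤ ∑ a : ZMod L, (∑ m ∈ Finset.range M, (if band m a then (2 : ℝ) ^ (m + 1) else 0) +
          (if t a ≤ τ then (2 : ℝ) ^ M else 0)) := Finset.sum_le_sum fun a _ => hpt a
    _ = ∑ m ∈ Finset.range M, (2 : ℝ) ^ (m + 1) * ((univ.filter fun a : ZMod L => band m a).card : ℝ) +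
          (2 : ℝ) ^ M * ((univ.filter fun a : ZMod L => t a ≤ τ).card : ℝ) := by
        rw [Finset.sum_add_distrib, Finset.sum_comm]
        congr 1
        · refine Finset.sum_congr rfl fun m _ => ?_
          rw [← Finset.sum_filter, Finset.sum_const, nsmul_eq_mul, mul_comm]
        · rw [← Finset.sum_filter, Finset.sum_const, nsmul_eq_mul, mul_comm]
    _ ≤ ∑ m ∈ Finset.range M, (2 : ℝ) ^ (m + 1) * (Real.sqrt 2 * (1 / 2 : ℝ) ^ m * L + 4) +
          (2 : ℝ) ^ M * (Real.sqrt 2 * τ * L + 4) := by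
        refine add_le_add (Finset.sum_le_sum fun m _ => ?_) ?_
        · exact mul_le_mul_of_nonneg_left (hcount m) (by positivity)
        · exact mul_le_mul_of_nonneg_left htail (by positivity)
    _ = 2 * Real.sqrt 2 * L * M + 8 * ∑ m ∈ Finset.range M, (2 : ℝ) ^ m +
          (Real.sqrt 2 * L + 4 * 2 ^ M) := by
        have hterm : ∀ m : ℕ, (2 : ℝ) ^ (m + 1) * (Real.sqrt 2 * (1 / 2 : ℝ) ^ m * L + 4) =
            2 * Real.sqrt 2 * L + 8 * 2 ^ m := by
          intro m
          have h22 : (2 : ℝ) ^ (m + 1) * (1 / 2 : ℝ) ^ m = 2 := by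
            rw [pow_succ, one_div_pow]
            field_simp
          calc (2 : ℝ) ^ (m + 1) * (Real.sqrt 2 * (1 / 2 : ℝ) ^ m * L + 4)
              = (2 : ℝ) ^ (m + 1) * (1 / 2 : ℝ) ^ m * (Real.sqrt 2 * L) + 4 * 2 ^ (m + 1) := by ring
            _ = 2 * Real.sqrt 2 * L + 8 * 2 ^ m := by rw [h22, pow_succ]; ring
        have htl : (2 : ℝ) ^ M * (Real.sqrt 2 * τ * L + 4) = Real.sqrt 2 * L + 4 * 2 ^ M := by
          calc (2 : ℝ) ^ M * (Real.sqrt 2 * τ * L + 4) = (τ * 2 ^ M) * (Real.sqrt 2 * L) + 4 * 2 ^ M := by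
                ring
            _ = Real.sqrt 2 * L + 4 * 2 ^ M := by rw [hτ2, one_mul]
        rw [Finset.sum_congr rfl fun m _ => hterm m, Finset.sum_add_distrib, Finset.sum_const,
          Finset.card_range, nsmul_eq_mul, ← Finset.mul_sum, htl]
        ring
    _ = 2 * Real.sqrt 2 * L * M + 8 * (2 ^ M - 1) + (Real.sqrt 2 * L + 4 * 2 ^ M) := by
        rw [geom_sum_eq (by norm_num : (2 : ℝ) ≠ 1)]
        norm_num
    _ ≤ (2 * M + 1) * Real.sqrt 2 * L + 12 * 2 ^ M := by
        have : (0 : ℝ) ≤ 2 ^ M := by positivity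
        nlinarith

end OneDim

/-! ### The two-dimensional count -/

section TwoDim

variable {L : ℕ} [NeZero L]

/-- **Directional class of the shell, weighted by rows.** For `i ∈ {0, 1}` with complementary
coordinate `j`, `τ > 0`, `η ≥ 0` and a level `μ`: the momenta `k` of the shell `|ε_L(k) - μ| < η`
with `max(|sin θ_j(k)|, τ) ≤ |sin θ_i(k)|` (`θ_i(k) = 2πk_i/L`) number at most
`Σ_{r ∈ ℤ/Lℤ} (ηL/(π·max(|sin(2πr/L)|, τ)) + 2)`: over the row `k_j = r` the condition reads
`|2cos θ_i + c_r| < η` with `|sin θ_i| ≥ s_r = max(|sin(2πr/L)|, τ)`, and for each sign of `sin θ_i`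
at most `ηL/(2π s_r) + 1` momenta qualify (`card_row_le`). [folklore] -/
theorem card_shell_dir_weighted_le (i : Fin 2) {τ η : ℝ} (hτ : 0 < τ) (hη : 0 ≤ η) (μ : ℝ) :
    ((univ.filter fun k : TorusSite 2 L => |torusBand L k - μ| < η ∧
        max |Real.sin (2 * π * ((k (if i = 0 then 1 else 0)).val : ℝ) / L)| τ ≤
          |Real.sin (2 * π * ((k i).val : ℝ) / L)|).card : ℝ) ≤
      ∑ r : ZMod L, (η * L / (π * max |Real.sin (2 * π * (r.val : ℝ) / L)| τ) + 2) := by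
  classical
  set j : Fin 2 := if i = 0 then 1 else 0 with hj
  have hij : ∀ k : TorusSite 2 L, torusBand L k - μ =
      -(2 * Real.cos (2 * π * ((k i).val : ℝ) / L) + (2 * Real.cos (2 * π * ((k j).val : ℝ) / L) + μ)) := by
    intro k
    rw [torusBand_two_eq]
    fin_cases i <;> simp [hj] <;> ring
  set S := univ.filter fun k : TorusSite 2 L => |torusBand L k - μ| < η ∧
        max |Real.sin (2 * π * ((k j).val : ℝ) / L)| τ ≤ |Real.sin (2 * π * ((k i).val : ℝ) / L)| with hS
  -- the two signed row sets of `card_row_le` for the row `r`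
  set R : ZMod L → Bool → Finset (ZMod L) := fun r pos => univ.filter fun a : ZMod L =>
      (if pos then max |Real.sin (2 * π * (r.val : ℝ) / L)| τ ≤ Real.sin (2 * π * (a.val : ℝ) / L)
        else Real.sin (2 * π * (a.val : ℝ) / L) ≤ -max |Real.sin (2 * π * (r.val : ℝ) / L)| τ) ∧
        |2 * Real.cos (2 * π * (a.val : ℝ) / L) + (2 * Real.cos (2 * π * (r.val : ℝ) / L) + μ)| < η
    with hR
  have hfib := Finset.card_eq_sum_card_fiberwise (f := fun k : TorusSite 2 L => k j) (s := S) (t := univ)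
    (fun _ _ => Finset.mem_univ _)
  have hrow : ∀ r : ZMod L, (((S.filter fun k => k j = r)).card : ℝ) ≤
      η * L / (π * max |Real.sin (2 * π * (r.val : ℝ) / L)| τ) + 2 := by
    intro r
    set s₀ : ℝ := max |Real.sin (2 * π * (r.val : ℝ) / L)| τ with hs₀
    have hs₀0 : 0 < s₀ := lt_max_of_lt_right hτ
    -- inject the fibre into `R r true ∪ R r false` by `k ↦ k i`
    have hle : ((S.filter fun k => k j = r)).card ≤ (R r true ∪ R r false).card := by
      refine Finset.card_le_card_of_injOn (fun k => k i) ?_ ?_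
      · intro k hk
        rw [Finset.mem_coe, Finset.mem_filter, hS, Finset.mem_filter] at hk
        obtain ⟨⟨_, hsh, hmax⟩, hkr⟩ := hk
        rw [hkr] at hmax
        rw [hij k, abs_neg, hkr] at hsh
        rw [Finset.mem_coe, Finset.mem_union]
        rcases le_abs'.1 hmax with h | h
        · right
          rw [hR, Finset.mem_filter]
          exact ⟨Finset.mem_univ _, by simpa using h, hsh⟩
        · left
          rw [hR, Finset.mem_filter]
          exact ⟨Finset.mem_univ _, by simpa using h, hsh⟩
      · intro k hk k' hk' hkk'
        rw [Finset.mem_coe, Finset.mem_filter] at hk hk'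
        funext l
        have hjj : k j = k' j := by rw [hk.2, hk'.2]
        have hii : k i = k' i := hkk'
        fin_cases i <;> fin_cases l <;> simp_all
    have h1 : ((R r true).card : ℝ) ≤ η * L / (2 * π * s₀) + 1 := by
      have := card_row_le (L := L) hs₀0 hη (2 * Real.cos (2 * π * (r.val : ℝ) / L) + μ) true
      simpa [hR, hs₀] using this
    have h2 : ((R r false).card : ℝ) ≤ η * L / (2 * π * s₀) + 1 := by
      have := card_row_le (L := L) hs₀0 hη (2 * Real.cos (2 * π * (r.val : ℝ) / L) + μ) false
      simpa [hR, hs₀] using this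
    have hu := Finset.card_union_le (R r true) (R r false)
    calc (((S.filter fun k => k j = r)).card : ℝ) ≤ ((R r true ∪ R r false).card : ℝ) := by
          exact_mod_cast hle
      _ ≤ ((R r true).card : ℝ) + (R r false).card := by exact_mod_cast hu
      _ ≤ (η * L / (2 * π * s₀) + 1) + (η * L / (2 * π * s₀) + 1) := add_le_add h1 h2
      _ = η * L / (π * s₀) + 2 := by
          field_simp
          ring
  calc (S.card : ℝ) = ∑ r : ZMod L, (((S.filter fun k => k j = r)).card : ℝ) := by
        rw [hfib]; push_cast; rfl
    _ ≤ ∑ r : ZMod L, (η * L / (π * max |Real.sin (2 * π * (r.val : ℝ) / L)| τ) + 2) :=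
        Finset.sum_le_sum fun r _ => hrow r

/-- `1.3862 ≤ log 4` (`log 4 = 2 log 2`, `log 2 > 0.6931471803`). [folklore] -/
theorem log_four_ge : (1.3862 : ℝ) ≤ Real.log 4 := by
  have h : Real.log 4 = 2 * Real.log 2 := by
    rw [show (4 : ℝ) = 2 ^ 2 by norm_num, Real.log_pow]; norm_num
  rw [h]
  have := Real.log_two_gt_d9
  linarith

/-- **Level counting on the torus at the van Hove rate, uniformly in the level.** For every `μ`
and `0 < η ≤ 1`: `#{k ∈ (ℤ/Lℤ)² : |ε_L(k) - μ| < η} ≤ 6 η log(4/η) L² + 52 L`. Proof: with the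
dyadic scale `τ = 2^{-M}`, `τ² < η ≤ 4τ²` (`4^M ≤ 4/η`), the corner `|sin θ₀|, |sin θ₁| ≤ τ` holds at
most `(√2 τ L + 4)² ≤ 4ηL² + 32` momenta (`card_filter_abs_sin_le` in each coordinate); every other
momentum of the shell has a dominant sine `|sin θ_i| ≥ max(|sin θ_j|, τ)` and the two directional
classes hold at most `2·((ηL/π)·((2M+1)√2 L + 12·2^M) + 2L)` momenta (`card_shell_dir_weighted_le`,
`sum_inv_max_abs_sin_le`); finally `2M + 5 ≤ 6 log(4/η)` (`M log 4 ≤ log(4/η)`, `log 4 ≤ log(4/η)`)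
and `η 2^M ≤ 2√η ≤ 2`. The `η log(1/η)` is the van Hove density of states, the `L` the row of momenta
on the level set `ε = 0`. [folklore] -/
theorem card_torusShell_lt_le_log {η : ℝ} (hη : 0 < η) (hη1 : η ≤ 1) (μ : ℝ) :
    ((univ.filter fun k : TorusSite 2 L => |torusBand L k - μ| < η).card : ℝ) ≤
      6 * η * Real.log (4 / η) * (L : ℝ) ^ 2 + 52 * L := by
  classical
  -- the dyadic scale
  obtain ⟨n, hn1, hn2⟩ := exists_nat_pow_near (x := 1 / η) (y := (4 : ℝ))
    (by rw [le_div_iff₀ hη]; linarith) (by norm_num)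
  set M : ℕ := n + 1 with hM
  set τ : ℝ := (1 / 2 : ℝ) ^ M with hτ
  have hτ0 : 0 < τ := by positivity
  have hτ4 : τ ^ 2 * 4 ^ M = 1 := by
    rw [hτ, ← pow_mul, mul_comm M 2, pow_mul, ← mul_pow]; norm_num
  have h4M : (4 : ℝ) ^ M = 4 * 4 ^ n := by rw [hM, pow_succ]; ring
  have hτη : τ ^ 2 < η := by
    -- `1/η < 4^(n+1) = 4^M = 1/τ²`
    have h : 1 / η < 4 ^ M := by rw [hM]; exact hn2
    rw [div_lt_iff₀ hη] at h
    calc τ ^ 2 = τ ^ 2 * 1 := by ring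
      _ < τ ^ 2 * (4 ^ M * η) := mul_lt_mul_of_pos_left h (by positivity)
      _ = η := by rw [← mul_assoc, hτ4, one_mul]
  have hητ : η ≤ 4 * τ ^ 2 := by
    -- `4^n ≤ 1/η`, so `η 4^M ≤ 4`, i.e. `η ≤ 4 τ²`
    have hn1' := hn1
    rw [le_div_iff₀ hη] at hn1'
    have hkey : 4 * τ ^ 2 * 4 ^ n = 1 := by rw [← hτ4, h4M]; ring
    calc η = (4 * τ ^ 2 * 4 ^ n) * η := by rw [hkey, one_mul]
      _ = 4 * τ ^ 2 * (4 ^ n * η) := by ring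
      _ ≤ 4 * τ ^ 2 * 1 := mul_le_mul_of_nonneg_left hn1' (by positivity)
      _ = 4 * τ ^ 2 := mul_one _
  have h2M : τ * 2 ^ M = 1 := by rw [hτ, ← mul_pow]; norm_num
  have hlog4 := log_four_ge
  have hlogη : Real.log 4 ≤ Real.log (4 / η) := by
    refine Real.log_le_log (by norm_num) ?_
    rw [le_div_iff₀ hη]; nlinarith
  have hl0 : 0 < Real.log 4 := by linarith
  have hMlog : (M : ℝ) * Real.log 4 ≤ Real.log (4 / η) := by
    have h : (4 : ℝ) ^ M ≤ 4 / η := by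
      rw [le_div_iff₀ hη, h4M]
      have hn1' := hn1
      rw [le_div_iff₀ hη] at hn1'
      linarith
    have := Real.log_le_log (by positivity) h
    rwa [Real.log_pow] at this
  -- the pieces
  set t : ZMod L → ℝ := fun a => |Real.sin (2 * π * (a.val : ℝ) / L)| with ht
  set A := univ.filter fun a : ZMod L => t a ≤ τ with hA
  set C := univ.filter fun k : TorusSite 2 L => t (k 0) ≤ τ ∧ t (k 1) ≤ τ with hC
  set D : Fin 2 → Finset (TorusSite 2 L) := fun i => univ.filter fun k : TorusSite 2 L =>
      |torusBand L k - μ| < η ∧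
        max |Real.sin (2 * π * ((k (if i = 0 then 1 else 0)).val : ℝ) / L)| τ ≤
          |Real.sin (2 * π * ((k i).val : ℝ) / L)| with hD
  have hcover : (univ.filter fun k : TorusSite 2 L => |torusBand L k - μ| < η) ⊆ C ∪ (D 0 ∪ D 1) := by
    intro k hk
    rw [Finset.mem_filter] at hk
    have hsh := hk.2
    rw [Finset.mem_union, Finset.mem_union]
    by_cases hc : t (k 0) ≤ τ ∧ t (k 1) ≤ τ
    · left
      rw [hC, Finset.mem_filter]
      exact ⟨Finset.mem_univ _, hc⟩
    · right
      rcases le_or_gt (t (k 1)) (t (k 0)) with h01 | h01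
      · left
        have h0 : τ ≤ t (k 0) := by
          by_contra h'
          push Not at h'
          exact hc ⟨h'.le, h01.trans h'.le⟩
        rw [hD]
        simp only [Finset.mem_filter, Finset.mem_univ, true_and]
        refine ⟨hsh, ?_⟩
        simpa [ht] using (max_le h01 h0)
      · right
        have h1 : τ ≤ t (k 1) := by
          by_contra h'
          push Not at h'
          exact hc ⟨(h01.trans h').le, h'.le⟩
        rw [hD]
        simp only [Finset.mem_filter, Finset.mem_univ, true_and]
        refine ⟨hsh, ?_⟩
        simpa [ht] using (max_le h01.le h1)
  -- corner: product bound
  have hAcard : (A.card : ℝ) ≤ Real.sqrt 2 * τ * L + 4 := card_filter_abs_sin_le hτ0.le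
  have hCcard : (C.card : ℝ) ≤ (Real.sqrt 2 * τ * L + 4) ^ 2 := by
    have hle : C.card ≤ (A ×ˢ A).card := by
      refine Finset.card_le_card_of_injOn (fun k => (k 0, k 1)) ?_ ?_
      · intro k hk
        rw [Finset.mem_coe, hC, Finset.mem_filter] at hk
        rw [Finset.mem_coe, Finset.mem_product, hA, Finset.mem_filter, Finset.mem_filter]
        exact ⟨⟨Finset.mem_univ _, hk.2.1⟩, ⟨Finset.mem_univ _, hk.2.2⟩⟩
      · intro k _ k' _ hkk'
        have h0 : k 0 = k' 0 := congrArg Prod.fst hkk'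
        have h1 : k 1 = k' 1 := congrArg Prod.snd hkk'
        funext l
        fin_cases l
        · exact h0
        · exact h1
    rw [Finset.card_product] at hle
    have hA0 : (0 : ℝ) ≤ A.card := Nat.cast_nonneg _
    calc (C.card : ℝ) ≤ (A.card : ℝ) * A.card := by exact_mod_cast hle
      _ ≤ (Real.sqrt 2 * τ * L + 4) * (Real.sqrt 2 * τ * L + 4) :=
          mul_le_mul hAcard hAcard hA0 (hA0.trans hAcard)
      _ = (Real.sqrt 2 * τ * L + 4) ^ 2 := by ring
  -- directional classes
  have hrowsum := sum_inv_max_abs_sin_le (L := L) M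
  have hDcard : ∀ i : Fin 2, ((D i).card : ℝ) ≤
      η * L / π * ((2 * M + 1) * Real.sqrt 2 * L + 12 * 2 ^ M) + 2 * L := by
    intro i
    have h := card_shell_dir_weighted_le (L := L) i hτ0 hη.le μ
    have hsplit : ∑ r : ZMod L, (η * L / (π * max |Real.sin (2 * π * (r.val : ℝ) / L)| τ) + 2) =
        η * L / π * ∑ r : ZMod L, 1 / max |Real.sin (2 * π * (r.val : ℝ) / L)| τ + 2 * L := by
      rw [Finset.sum_add_distrib, Finset.mul_sum, Finset.sum_const, Finset.card_univ, ZMod.card,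
        nsmul_eq_mul]
      congr 1
      · refine Finset.sum_congr rfl fun r _ => ?_
        rw [mul_one_div, div_div]
      · ring
    rw [hsplit] at h
    refine h.trans (add_le_add (mul_le_mul_of_nonneg_left ?_ (by positivity)) le_rfl)
    simpa [hτ] using hrowsum
  -- numerics
  have hs2 : Real.sqrt 2 ≤ 3 / 2 := Real.sqrt_two_lt_three_halves.le
  have hs20 : 0 ≤ Real.sqrt 2 := Real.sqrt_nonneg _
  have hπ3 : (3 : ℝ) ≤ π := Real.pi_gt_three.le
  have hL0 : (0 : ℝ) ≤ L := Nat.cast_nonneg _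
  have hL1 : (1 : ℝ) ≤ L := by exact_mod_cast Nat.one_le_iff_ne_zero.2 (NeZero.ne L)
  have hτ1 : τ ≤ 1 / 2 := by
    rw [hτ, hM, pow_succ]
    have : (1 / 2 : ℝ) ^ n ≤ 1 := pow_le_one₀ (by norm_num) (by norm_num)
    linarith [mul_le_mul_of_nonneg_right this (by norm_num : (0 : ℝ) ≤ 1 / 2)]
  -- `η 2^M ≤ 2`: `η/τ ≤ 4τ ≤ 2`
  have hη2M : η * 2 ^ M ≤ 2 := by
    have h1 : η * 2 ^ M = η / τ := by
      rw [eq_div_iff hτ0.ne', mul_assoc, mul_comm _ τ, h2M, mul_one]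
    rw [h1, div_le_iff₀ hτ0]
    have := mul_le_mul_of_nonneg_left hτ1 hτ0.le
    nlinarith
  -- corner ≤ 4ηL² + 32
  have hC' : (C.card : ℝ) ≤ 4 * η * (L : ℝ) ^ 2 + 32 := by
    refine hCcard.trans ?_
    have h1 : (Real.sqrt 2 * τ * L + 4) ^ 2 ≤ 2 * (Real.sqrt 2 * τ * L) ^ 2 + 32 := by
      nlinarith [sq_nonneg (Real.sqrt 2 * τ * L - 4)]
    have h2 : (Real.sqrt 2 * τ * L) ^ 2 = 2 * τ ^ 2 * (L : ℝ) ^ 2 := by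
      rw [mul_pow, mul_pow, Real.sq_sqrt (by norm_num : (0 : ℝ) ≤ 2)]
    rw [h2] at h1
    have h3 := mul_le_mul_of_nonneg_right hτη.le (sq_nonneg (L : ℝ))
    linarith
  -- directional ≤ (M + 1/2) η L² + 10 L each
  have hD' : ∀ i : Fin 2, ((D i).card : ℝ) ≤ ((M : ℝ) + 1 / 2) * η * (L : ℝ) ^ 2 + 10 * L := by
    intro i
    refine (hDcard i).trans ?_
    -- `ηL/π · (2M+1)√2 L ≤ (M + 1/2) η L²` (`√2/π ≤ 1/2`) and `ηL/π · 12·2^M ≤ 8L`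
    have hπ0 : (0 : ℝ) < π := Real.pi_pos
    have hA1 : η * L / π * ((2 * M + 1) * Real.sqrt 2 * L) ≤ ((M : ℝ) + 1 / 2) * η * (L : ℝ) ^ 2 := by
      rw [div_mul_eq_mul_div, div_le_iff₀ hπ0]
      have hM0 : (0 : ℝ) ≤ 2 * M + 1 := by positivity
      have : η * L * ((2 * M + 1) * Real.sqrt 2 * L) = (2 * M + 1) * Real.sqrt 2 * (η * (L : ℝ) ^ 2) := by
        ring
      rw [this]
      have : ((M : ℝ) + 1 / 2) * η * (L : ℝ) ^ 2 * π = (2 * M + 1) * (π / 2) * (η * (L : ℝ) ^ 2) := by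
        ring
      rw [this]
      have hηL : 0 ≤ η * (L : ℝ) ^ 2 := by positivity
      exact mul_le_mul_of_nonneg_right (mul_le_mul_of_nonneg_left (by linarith) hM0) hηL
    have hA2 : η * L / π * (12 * 2 ^ M) ≤ 8 * L := by
      rw [div_mul_eq_mul_div, div_le_iff₀ hπ0]
      have : η * L * (12 * 2 ^ M) = 12 * (η * 2 ^ M) * L := by ring
      rw [this]
      nlinarith
    have : η * L / π * ((2 * M + 1) * Real.sqrt 2 * L + 12 * 2 ^ M) =
        η * L / π * ((2 * M + 1) * Real.sqrt 2 * L) + η * L / π * (12 * 2 ^ M) := by ring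
    rw [this]
    linarith
  -- assemble
  have hunion : ((univ.filter fun k : TorusSite 2 L => |torusBand L k - μ| < η).card : ℝ) ≤
      (C.card : ℝ) + ((D 0).card + (D 1).card) := by
    have h1 := Finset.card_le_card hcover
    have h2 := Finset.card_union_le C (D 0 ∪ D 1)
    have h3 := Finset.card_union_le (D 0) (D 1)
    exact_mod_cast h1.trans (h2.trans (Nat.add_le_add_left h3 _))
  have hM' : 2 * (M : ℝ) + 5 ≤ 6 * Real.log (4 / η) := by
    -- `(2M + 5) log 4 ≤ 7 log(4/η) ≤ 6 log(4/η) · log 4` (`M log 4 ≤ log(4/η)`, `7 ≤ 6 log 4`)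
    have hX0 : 0 ≤ Real.log (4 / η) := hl0.le.trans hlogη
    have h1 : 2 * ((M : ℝ) * Real.log 4) + 5 * Real.log 4 ≤ 7 * Real.log (4 / η) := by linarith
    have h2 : 7 * Real.log (4 / η) ≤ 6 * Real.log (4 / η) * Real.log 4 := by
      have h76 : (7 : ℝ) ≤ 6 * Real.log 4 := by linarith
      have := mul_le_mul_of_nonneg_left h76 hX0
      calc 7 * Real.log (4 / η) = Real.log (4 / η) * 7 := by ring
        _ ≤ Real.log (4 / η) * (6 * Real.log 4) := this
        _ = 6 * Real.log (4 / η) * Real.log 4 := by ring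
    have h3 : (2 * (M : ℝ) + 5) * Real.log 4 ≤ (6 * Real.log (4 / η)) * Real.log 4 := by
      calc (2 * (M : ℝ) + 5) * Real.log 4 = 2 * ((M : ℝ) * Real.log 4) + 5 * Real.log 4 := by ring
        _ ≤ 7 * Real.log (4 / η) := h1
        _ ≤ (6 * Real.log (4 / η)) * Real.log 4 := h2
    exact le_of_mul_le_mul_right h3 hl0
  have hηL2 : 0 ≤ η * (L : ℝ) ^ 2 := by positivity
  calc ((univ.filter fun k : TorusSite 2 L => |torusBand L k - μ| < η).card : ℝ)
      ≤ (C.card : ℝ) + ((D 0).card + (D 1).card) := hunion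
    _ ≤ (4 * η * (L : ℝ) ^ 2 + 32) + ((((M : ℝ) + 1 / 2) * η * (L : ℝ) ^ 2 + 10 * L) +
          (((M : ℝ) + 1 / 2) * η * (L : ℝ) ^ 2 + 10 * L)) := add_le_add hC' (add_le_add (hD' 0) (hD' 1))
    _ = (2 * (M : ℝ) + 5) * (η * (L : ℝ) ^ 2) + 20 * L + 32 := by ring
    _ ≤ 6 * Real.log (4 / η) * (η * (L : ℝ) ^ 2) + 20 * L + 32 * L := by
        have := mul_le_mul_of_nonneg_right hM' hηL2
        linarith
    _ = 6 * η * Real.log (4 / η) * (L : ℝ) ^ 2 + 52 * L := by ring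

/-- **The same count, written for widths up to `4`.** For every `μ` and `0 < η ≤ 4`:
`#{k ∈ (ℤ/Lℤ)² : |ε_L(k) - μ| < η} ≤ 6 η log(16/η) L² + 52 L` (for `η ≤ 1` this is weaker than
`card_torusShell_lt_le_log`; for `1 < η ≤ 4` the trivial count `L²` is below `6 η log(16/η) L²`
because `log(16/η) ≥ log 4 ≥ 1`). This is the form consumed by 4-adic layer cakes whose last shell
may have width up to `4`. [folklore] -/
theorem card_torusShell_lt_le_log' {η : ℝ} (hη : 0 < η) (hη4 : η ≤ 4) (μ : ℝ) :
    ((univ.filter fun k : TorusSite 2 L => |torusBand L k - μ| < η).card : ℝ) ≤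
      6 * η * Real.log (16 / η) * (L : ℝ) ^ 2 + 52 * L := by
  classical
  have hL0 : (0 : ℝ) ≤ L := Nat.cast_nonneg _
  have hlog4 := log_four_ge
  have hlog16 : Real.log 4 ≤ Real.log (16 / η) := by
    refine Real.log_le_log (by norm_num) ?_
    rw [le_div_iff₀ hη]; nlinarith
  rcases le_or_gt η 1 with h1 | h1
  · refine (card_torusShell_lt_le_log hη h1 μ).trans ?_
    have hmono : Real.log (4 / η) ≤ Real.log (16 / η) :=
      Real.log_le_log (by positivity) (by rw [div_le_div_iff_of_pos_right hη]; norm_num)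
    have h0 : 0 ≤ 6 * η * (L : ℝ) ^ 2 := by positivity
    have h6 : 6 * η * Real.log (4 / η) * (L : ℝ) ^ 2 ≤ 6 * η * Real.log (16 / η) * (L : ℝ) ^ 2 := by
      have := mul_le_mul_of_nonneg_left hmono h0
      calc 6 * η * Real.log (4 / η) * (L : ℝ) ^ 2 = 6 * η * (L : ℝ) ^ 2 * Real.log (4 / η) := by ring
        _ ≤ 6 * η * (L : ℝ) ^ 2 * Real.log (16 / η) := this
        _ = 6 * η * Real.log (16 / η) * (L : ℝ) ^ 2 := by ring
    linarith
  · -- trivial count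
    have hcard : ((univ.filter fun k : TorusSite 2 L => |torusBand L k - μ| < η).card : ℝ) ≤ (L : ℝ) ^ 2 := by
      have := Finset.card_filter_le (univ : Finset (TorusSite 2 L)) (fun k => |torusBand L k - μ| < η)
      rw [Finset.card_univ, card_torusSite] at this
      exact_mod_cast this
    refine hcard.trans ?_
    have hηlog : 1 ≤ η * Real.log (16 / η) := one_le_mul_of_one_le_of_one_le h1.le (by linarith)
    have hx0 : 0 ≤ η * Real.log (16 / η) * (L : ℝ) ^ 2 := by
      have : 0 ≤ η * Real.log (16 / η) := by linarith
      positivity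
    have h := mul_le_mul_of_nonneg_right hηlog (sq_nonneg (L : ℝ))
    calc (L : ℝ) ^ 2 = 1 * (L : ℝ) ^ 2 := by ring
      _ ≤ η * Real.log (16 / η) * (L : ℝ) ^ 2 := h
      _ ≤ 6 * (η * Real.log (16 / η) * (L : ℝ) ^ 2) + 52 * L := by nlinarith
      _ = 6 * η * Real.log (16 / η) * (L : ℝ) ^ 2 + 52 * L := by ring

end TwoDim

end Literature.MathematicalPhysics.QuantumLattice
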